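import Summits.Ventures.PercRepro.RankLevelSetPrimeCover
import Summits.Ventures.PercRepro.RankLevelSetPlaneSix

/-!
# PercRepro — THE USERS LEMMA: two points sharing a cover side (p9, gen 27)

Call `y ∈ G ∖ H` a USER of the `G`-closed set `H` if `H` is a side of a cover of `y`: there is a `G`-closed `K` with
`y ∉ K` and `G ∖ {y} ⊆ H ∪ K`.  If `y ≠ y'` are two users of `H` with other sides `K`, `K'`, then `y ∈ K'` and
`y' ∈ K`, so `K ∪ K' ⊇ K ∪ {y}` has rank `≥ r(K) + 1` (`y ∉ cl(K)`), and submodularity gives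
`r(K ∩ K') + 1 ≤ r(K') < r(G)`: the `G`-closed set `K ∩ K'` has corank `≥ 2` in `G`.  Every point of `G` outside
`H ∪ {y, y'}` lies in `K ∩ K'`, so `(G ∖ H) ∖ {y, y'}` has rank `≤ r(G) − 2`; in the `e`-free core of rank `≤ 5` it is a
set of rank `≤ 3`, hence of at most `6` points (`ncard_le_six_of_eRk_le_three_of_free`): `|G| ≤ |H| + 8`.
Consequence (the sparse corner of the `f(5)` census, proofs/P9-FLATBOUND-g25.md §7(c)): in a `16`-point rank-`5` set of
the core a `7`-point side serves exactly ONE point.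

* **`mem_side_of_cover`** — a point of `G ∖ H` other than the covered point lies in the other side;
* **`eRk_inter_add_two_le_of_two_users`** — `r(K ∩ K') + 2 ≤ r(G)` (the rank form);
* **`sdiff_subset_inter_of_two_users`** — `(G ∖ H) ∖ {y, y'} ⊆ K ∩ K'`;
* **`eRk_sdiff_add_two_le_of_two_users`** — `r((G ∖ H) ∖ {y, y'}) + 2 ≤ r(G)`;
* **`ncard_le_ncard_add_eight_of_two_users`** — `|G| ≤ |H| + 8` when `r(G) ≤ 5` (the counting form);
* **`eq_of_users_of_ncard_le_seven`** — a side of `≤ 7` points of a `≥ 16`-point set of rank `≤ 5` has one user.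
Axioms: standard.  Nothing here moves a window; NO window claim (p9 owns S4).
-/

open scoped Matroid

namespace PercRepro

namespace ThmN

open Set

variable {α : Type}

/-- A point `z ∈ G ∖ H`, `z ≠ y`, lies in the other side `K` of a cover `(H, K)` of `y`. -/
theorem mem_side_of_cover {G H K : Set α} {y z : α} (hz : z ∈ G) (hzH : z ∉ H) (hzy : z ≠ y)
    (hcov : G \ {y} ⊆ H ∪ K) : z ∈ K := by
  rcases hcov ⟨hz, hzy⟩ with h | h
  · exact absurd h hzH
  · exact h

/-- **The users lemma, rank form**: if `y ∉ K` (`K` `G`-closed), `y ∈ K'` and `y' ∈ G ∖ K'` (`K'` `G`-closed), then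
`r(K ∩ K') + 2 ≤ r(G)`. -/
theorem eRk_inter_add_two_le_of_two_users (M : Matroid α) [M.Finite] {G K K' : Set α} {y y' : α}
    (hG : G ⊆ M.E) (hK : GClosed M G K) (hK' : GClosed M G K') (hy : y ∈ G) (hy' : y' ∈ G)
    (hyK : y ∉ K) (hyK' : y ∈ K') (hy'K' : y' ∉ K') : M.eRk (K ∩ K') + 2 ≤ M.eRk G := by
  have hyE : y ∈ M.E \ M.closure K := ⟨hG hy, notMem_closure_of_gclosed hK hy hyK⟩
  have h1 : M.eRk (insert y K) = M.eRk K + 1 := Matroid.eRk_insert_eq_add_one hyE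
  have h2 : M.eRk K + 1 ≤ M.eRk (K ∪ K') := by
    rw [← h1]
    exact M.eRk_mono (Set.insert_subset (Set.mem_union_right K hyK') Set.subset_union_left)
  have h3 := M.eRk_inter_add_eRk_union_le K K'
  have h4 : M.eRk K' < M.eRk G := eRk_lt_of_gclosed_ssubset M hG hK' hy' hy'K'
  have hKfin : M.eRk K ≠ ⊤ :=
    (M.isRkFinite_of_finite (M.ground_finite.subset (hK.1.trans hG))).eRk_lt_top.ne
  have hK'fin : M.eRk K' ≠ ⊤ :=
    (M.isRkFinite_of_finite (M.ground_finite.subset (hK'.1.trans hG))).eRk_lt_top.ne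
  have h5 : M.eRk (K ∩ K') + (M.eRk K + 1) ≤ M.eRk K + M.eRk K' :=
    le_trans (add_le_add le_rfl h2) h3
  have h6 : M.eRk (K ∩ K') + 1 ≤ M.eRk K' := by
    have h : (M.eRk (K ∩ K') + 1) + M.eRk K ≤ M.eRk K' + M.eRk K := by
      calc (M.eRk (K ∩ K') + 1) + M.eRk K = M.eRk (K ∩ K') + (M.eRk K + 1) := by ring
        _ ≤ M.eRk K + M.eRk K' := h5
        _ = M.eRk K' + M.eRk K := by ring
    exact (ENat.add_le_add_iff_right hKfin).1 h
  have h7 : M.eRk K' + 1 ≤ M.eRk G := (ENat.add_one_le_iff hK'fin).2 h4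
  calc M.eRk (K ∩ K') + 2 = (M.eRk (K ∩ K') + 1) + 1 := by ring
    _ ≤ M.eRk K' + 1 := add_le_add h6 le_rfl
    _ ≤ M.eRk G := h7

/-- The points of `G` outside `H ∪ {y, y'}` lie in both other sides. -/
theorem sdiff_subset_inter_of_two_users {G H K K' : Set α} {y y' : α} (hcov : G \ {y} ⊆ H ∪ K)
    (hcov' : G \ {y'} ⊆ H ∪ K') : (G \ H) \ {y, y'} ⊆ K ∩ K' := by
  intro z hz
  have hzy : z ≠ y := fun h => hz.2 (Set.mem_insert_iff.2 (Or.inl h))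
  have hzy' : z ≠ y' := fun h => hz.2 (Set.mem_insert_iff.2 (Or.inr (Set.mem_singleton_iff.2 h)))
  exact ⟨mem_side_of_cover hz.1.1 hz.1.2 hzy hcov, mem_side_of_cover hz.1.1 hz.1.2 hzy' hcov'⟩

/-- **The users lemma**: two distinct users `y ≠ y'` of the side `H` (with other sides `K`, `K'`) leave
`(G ∖ H) ∖ {y, y'}` of rank `≤ r(G) − 2`. -/
theorem eRk_sdiff_add_two_le_of_two_users (M : Matroid α) [M.Finite] {G H K K' : Set α} {y y' : α}
    (hG : G ⊆ M.E) (hK : GClosed M G K) (hK' : GClosed M G K') (hy : y ∈ G) (hy' : y' ∈ G)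
    (hyH : y ∉ H) (hne : y ≠ y') (hyK : y ∉ K) (hy'K' : y' ∉ K')
    (hcov : G \ {y} ⊆ H ∪ K) (hcov' : G \ {y'} ⊆ H ∪ K') :
    M.eRk ((G \ H) \ {y, y'}) + 2 ≤ M.eRk G := by
  have hyK' : y ∈ K' := mem_side_of_cover hy hyH hne hcov'
  have h := eRk_inter_add_two_le_of_two_users M hG hK hK' hy hy' hyK hyK' hy'K'
  exact le_trans (add_le_add (M.eRk_mono (sdiff_subset_inter_of_two_users hcov hcov')) le_rfl) h

/-- **The users lemma, counting form**: in the `e`-free core, if `G` has rank `≤ 5` and the side `H ⊆ G` has two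
distinct users, then `|G| ≤ |H| + 8` (the other `≤ 6` points form a set of rank `≤ 3`). -/
theorem ncard_le_ncard_add_eight_of_two_users (M : Matroid α) [M.Finite]
    (hfree : ∀ e ∈ M.E, ∃ A ⊆ M.E \ {e}, e ∉ M.closure A ∧ e ∉ M.closure ((M.E \ {e}) \ A))
    {G H K K' : Set α} {y y' : α} (hG : G ⊆ M.E) (hH : H ⊆ G) (hK : GClosed M G K)
    (hK' : GClosed M G K') (hy : y ∈ G) (hy' : y' ∈ G) (hyH : y ∉ H) (hy'H : y' ∉ H) (hne : y ≠ y')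
    (hyK : y ∉ K) (hy'K' : y' ∉ K') (hcov : G \ {y} ⊆ H ∪ K) (hcov' : G \ {y'} ⊆ H ∪ K')
    (hr : M.eRk G ≤ 5) : G.ncard ≤ H.ncard + 8 := by
  have hGfin : G.Finite := M.ground_finite.subset hG
  have hS : M.eRk ((G \ H) \ {y, y'}) + 2 ≤ M.eRk G :=
    eRk_sdiff_add_two_le_of_two_users M hG hK hK' hy hy' hyH hne hyK hy'K' hcov hcov'
  have hS3 : M.eRk ((G \ H) \ {y, y'}) ≤ 3 := by
    have h : M.eRk ((G \ H) \ {y, y'}) + 2 ≤ 3 + 2 := by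
      calc M.eRk ((G \ H) \ {y, y'}) + 2 ≤ M.eRk G := hS
        _ ≤ 5 := hr
        _ = 3 + 2 := by norm_num
    exact (ENat.add_le_add_iff_right (by norm_num : (2 : ℕ∞) ≠ ⊤)).1 h
  have hS6 : ((G \ H) \ {y, y'}).ncard ≤ 6 :=
    ncard_le_six_of_eRk_le_three_of_free M hfree
      ((Set.sdiff_subset.trans Set.sdiff_subset).trans hG) hS3
  -- `|G| = |H| + |G ∖ H|` and `|G ∖ H| = |(G ∖ H) ∖ {y, y'}| + 2`
  have hpair : ({y, y'} : Set α) ⊆ G \ H := by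
    intro z hz
    rcases hz with rfl | hz
    · exact ⟨hy, hyH⟩
    · rw [Set.mem_singleton_iff] at hz
      subst hz
      exact ⟨hy', hy'H⟩
  have h1 : ((G \ H) \ {y, y'}).ncard + ({y, y'} : Set α).ncard = (G \ H).ncard :=
    Set.ncard_sdiff_add_ncard_of_subset hpair (hGfin.subset Set.sdiff_subset)
  have h2 : (G \ H).ncard + H.ncard = G.ncard := Set.ncard_sdiff_add_ncard_of_subset hH hGfin
  rw [Set.ncard_pair hne] at h1
  omega

/-- **A small side has one user**: in the `e`-free core, a side `H` of at most `7` points of a set `G` of at least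
`16` points and rank `≤ 5` cannot have two distinct users — `y = y'`. -/
theorem eq_of_users_of_ncard_le_seven (M : Matroid α) [M.Finite]
    (hfree : ∀ e ∈ M.E, ∃ A ⊆ M.E \ {e}, e ∉ M.closure A ∧ e ∉ M.closure ((M.E \ {e}) \ A))
    {G H K K' : Set α} {y y' : α} (hG : G ⊆ M.E) (hH : H ⊆ G) (hK : GClosed M G K)
    (hK' : GClosed M G K') (hy : y ∈ G) (hy' : y' ∈ G) (hyH : y ∉ H) (hy'H : y' ∉ H)
    (hyK : y ∉ K) (hy'K' : y' ∉ K') (hcov : G \ {y} ⊆ H ∪ K) (hcov' : G \ {y'} ⊆ H ∪ K')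
    (hr : M.eRk G ≤ 5) (hG16 : 16 ≤ G.ncard) (hH7 : H.ncard ≤ 7) : y = y' := by
  by_contra hne
  have := ncard_le_ncard_add_eight_of_two_users M hfree hG hH hK hK' hy hy' hyH hy'H hne hyK hy'K'
    hcov hcov' hr
  omega

end ThmN

end PercRepro
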